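import Literature.MathematicalPhysics.QuantumChemistry.ThreeIndexRelaxationBound
import Summits.Ventures.CertifiedQuantumChemistry.Rows.GMatrixRelaxationKernel
import HarnessLib

/-!
# Ventures/CertifiedQuantumChemistry — Rows/T2PrimeRelaxationKernel.lean: the `T2′` border kernel
# (rdm-A, addendum 17, Theorem F2) at RELAXATION level, and the two-body `S_z` selection rule it forces

HONEST FRAMING (verbatim): certified bounds for a stated model Hamiltonian in a stated basis; not a
claim about the real molecule beyond that model.

Seat rdm-A (gen 55), zero compute; ROWS courtesy file (no row, no claim node, no certificate sentence,
nothing asserted about any model; no instance, reader or FORMAT byte changes). Companion of rdm-B's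
STATE-level `Rows/T2PrimeSectorKernel.lean` (`T2′(ψ) u_p = 0` for a sector VECTOR `ψ`), whose docstring
leaves "the ROW-IMPLIED (relaxation-level) version of F2" to rdm-A, and sequel of rdm-A's
`Rows/GMatrixRelaxationKernel.lean` (face F1 = theorem F3.2 at relaxation level; its E2 lemmas
`sum_two_upUp/upDown/downDown/downUp_of_isDQGFeasibleSector` are the engine here). Source text:
`pub-qchem-rdm/FORMAT-qcl1-addendum-17-faces.md` §F.3 (Theorem F2; there verified in exact rational
arithmetic on the `k = 4, 5, 6` files only).

Setting: the tree's PRINTED programmes on an ABSTRACT pair `(γ, Γ)` over the spin orbitals `Orb Λ` —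
`IsDQGFeasibleSector a b γ Γ` (Mazziotti 2007 §II.F eqs. (87)–(90); Nakata et al. 2008 condition types
(4)–(5)) and its three-index strengthening `IsDQGT1T2PrimeFeasibleSector a b γ Γ` (`T1 ⪰ 0`, `T2′ ⪰ 0`,
Nakata et al. 2008 §II.A–B) — with the printed block matrix `t2PrimeMap γ Γ = ( T2 X ; X† γ )` on
`(Orb Λ)³ ⊕ Orb Λ`. For a row label `P : Orb Λ` and spin weights `w : Fin 2 → ℂ` with
`w_α N_α + w_β N_β = 0` the BORDER VECTOR is `u = Σ_Y w_{s(Y)} e_{(P,Y,Y)} + w_{s(P)} e_P` (`s` = spin;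
for `P = pα`, `w = (b, −a)` it is rdm-B's `u_p`, for `P = pβ`, `w = (−b, a)` its `β` twin — the same
vectors written spin-uniformly, the spin sum `Σ_Y` replacing `Σ_q (… qα … + … qβ …)`). Proved here, for
every `Λ`, every sector with `a + b ≠ 0`, every `P` and every such `w`:
* `t2PrimeMap_mulVec_borderVec_inl` / `_inr` (closed form; DQG-sector rows only): `(T2′ u)_{(i,j,k)} =
  (w_{s(k)} + w_{s(P)} − w_{s(i)} − w_{s(j)}) Γ_{(i,j),(P,k)}` and `(T2′ u)_l = 0` — the printed `T2`
  row contracted against `u` leaves, after antisymmetry, the weighted E2 contraction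
  `Σ_Y w_{s(Y)} Γ_{(Q,Y),(k,Y)} = −w_{s(k)} γ_{Qk}` and the selection rule of `γ`, exactly ONE entry of
  `Γ` with a spin-charge coefficient (in the tree's abstract programme `Γ` is NOT spin-blocked a
  priori — only `γ` carries a selection-rule row — so this is the honest relaxation-level statement);
* `star_borderVec_dotProduct_t2PrimeMap_mulVec_borderVec` (identity): `u† T2′ u = 0` at every
  DQG-sector-feasible pair (on the support `(P,Y,Y)` of `u` the coefficient is
  `w_{s(Y)} + w_{s(P)} − w_{s(P)} − w_{s(Y)} = 0`);
* `t2PrimeMap_mulVec_borderVec_eq_zero` (F2 at RELAXATION level): at every feasible point of the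
  printed sector `DQGT1T2′` programme `T2′(γ, Γ) u = 0` — `T2′ ⪰ 0` turns the zero form into a kernel
  vector (`Matrix.PosSemidef.dotProduct_mulVec_zero_iff`), not only at `N`-representable points;
* `two_spin_sel_of_isDQGT1T2PrimeFeasibleSector` (consequence): the printed sector `DQGT1T2′`
  programme FORCES the two-body `S_z` selection rule `Γ_{(i,j),(P,k)} = 0` whenever
  `s(i) + s(j) ≠ s(P) + s(k)` — read off the kernel rows with `w = (b, −a)`, whose coefficient is
  `±(a + b) ≠ 0` exactly at those entries;
* `t2PrimeMap_mulVec_borderVec_eq_zero_of_two_spin_sel` (F2, LINEAR version): conversely, if `Γ`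
  obeys the two-body selection rule (as every `qcl1` instance does structurally — only
  charge-conserving members are emitted), then `T2′ u = 0` follows from the DQG-sector ROWS alone, no
  semidefiniteness used: the twin of addendum 17's "row-implied (LINEAR) version, member by member".
Words only: once `w_{s(P)} ≠ 0` the border part of `u` is a nonzero multiple of `e_P`, so on the pinned
rows the `T2′` block has no positive-definite feasible point and its border coordinates are redundant
faces (addendum 17 §F.3 COROLLARY "`T2′ ≡ T2` by congruence", which needs `N_α, N_β ≥ 1`; NOT
formalised here). Everything is PROVED (0 sorry, 0 def).

References: M. Nakata, B. J. Braams, K. Fujisawa, M. Fukuda, J. K. Percus, M. Yamashita, Z. Zhao,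
J. Chem. Phys. 128 (2008) 164113, §II.A–B (`T2`; `T2′ = ( T2 X ; X† γ )`, "obtained by slightly
strengthening `T2`"), p. 164113-5 condition types (4), (5), (7). [cite: NakataEtAl2008, §II.B]
D. A. Mazziotti, Adv. Chem. Phys. 134 (Wiley, 2007) 21–59, §II.F eqs. (87)–(90).
[cite: Mazziotti2007RDMChapter, §II.F eqs. (87)-(90)]
-/

noncomputable section

namespace Summit.Ventures.CertifiedQuantumChemistry

open Matrix Finset
open Literature.MathematicalPhysics.QuantumLattice Literature.MathematicalPhysics.QuantumChemistry
open scoped ComplexOrder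

variable {Λ : Type*} [LinearOrder Λ] [Fintype Λ]

/-! ### Bookkeeping: spin-split sums; the blocks of `T2′` against the two parts of the border vector -/

omit [LinearOrder Λ] in
/-- A sum over the spin orbitals `Orb Λ = Λ ×ₗ Fin 2`, split by spin. [folklore] -/
private theorem sum_orb_eq {M : Type*} [AddCommMonoid M] (F : Orb Λ → M) :
    ∑ P, F P = ∑ p, (F (orb p 0) + F (orb p 1)) := by
  have h : ∑ P, F P = ∑ p, ∑ σ : Fin 2, F (orb p σ) := by
    rw [← Fintype.sum_prod_type' (fun p (σ : Fin 2) => F (orb p σ))]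
    exact Fintype.sum_equiv ofLex _ _ fun _ => rfl
  rw [h]
  exact Finset.sum_congr rfl fun p _ => Fin.sum_univ_two _

/-- A block with cubic column index against the cubic part `Σ_Y w_{s(Y)} e_{(P,Y,Y)}` of the border
vector: `(M g)_I = Σ_Y w_{s(Y)} M_{I,(P,Y,Y)}`. -/
private theorem mulVec_cubicVec_apply {m : Type*} (M : Matrix m (Orb Λ × Orb Λ × Orb Λ) ℂ)
    (w : Fin 2 → ℂ) (P : Orb Λ) (I : m) :
    (M *ᵥ fun t : Orb Λ × Orb Λ × Orb Λ =>
        ∑ Y : Orb Λ, if t = (P, Y, Y) then w (ofLex Y).2 else 0) I =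
      ∑ Y : Orb Λ, w (ofLex Y).2 * M I (P, Y, Y) := by
  show ∑ J, M I J * _ = _
  simp only [Finset.mul_sum, mul_ite, mul_zero]
  rw [Finset.sum_comm]
  refine Finset.sum_congr rfl fun Y _ => ?_
  rw [Finset.sum_ite_eq', if_pos (Finset.mem_univ _)]
  exact mul_comm _ _

/-- A block with orbital column index against the border part `c e_P`: `(M h)_I = c M_{I,P}`. -/
private theorem mulVec_borderVec_apply {m : Type*} (M : Matrix m (Orb Λ) ℂ) (c : ℂ) (P : Orb Λ)
    (I : m) : (M *ᵥ fun l : Orb Λ => if l = P then c else 0) I = c * M I P := by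
  show ∑ l, M I l * _ = _
  simp only [mul_ite, mul_zero, Finset.sum_ite_eq', Finset.mem_univ, if_true]
  exact mul_comm _ _

/-- The selection rule of `γ` for arbitrary spin-orbital labels. -/
private theorem spin_sel_orb {a b : ℕ} {γ : Matrix (Orb Λ) (Orb Λ) ℂ}
    {Γ : Matrix (Orb Λ × Orb Λ) (Orb Λ × Orb Λ) ℂ} (h : IsDQGFeasibleSector a b γ Γ) {j k : Orb Λ}
    (hjk : (ofLex j).2 ≠ (ofLex k).2) : γ j k = 0 :=
  h.spin_sel (ofLex j).1 (ofLex k).1 (ofLex j).2 (ofLex k).2 hjk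

/-- `(w_{s(j)} − w_{s(k)}) γ_{jk} = 0`: either the spins agree or the selection rule kills `γ_{jk}`. -/
private theorem weight_sub_mul_one {a b : ℕ} {γ : Matrix (Orb Λ) (Orb Λ) ℂ}
    {Γ : Matrix (Orb Λ × Orb Λ) (Orb Λ × Orb Λ) ℂ} (h : IsDQGFeasibleSector a b γ Γ) (w : Fin 2 → ℂ)
    (j k : Orb Λ) : (w (ofLex j).2 - w (ofLex k).2) * γ j k = 0 := by
  by_cases hjk : (ofLex j).2 = (ofLex k).2
  · rw [hjk, sub_self, zero_mul]
  · rw [spin_sel_orb h hjk, mul_zero]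

/-- **The weighted E2 contraction.** For `w_α N_α + w_β N_β = 0` and `a + b ≠ 0`:
`Σ_Y w_{s(Y)} Γ_{(Q,Y),(k,Y)} = −w_{s(k)} γ_{Q,k}` — the four E2 families of
`GMatrixRelaxationKernel.lean` (`Σ_y Γ_{(Q,yτ),(qκ,yτ)} = (N_τ − [τ = κ]) γ_{Q,qκ}`) summed with the
weights. -/
private theorem sum_weight_mul_two {a b : ℕ} {γ : Matrix (Orb Λ) (Orb Λ) ℂ}
    {Γ : Matrix (Orb Λ × Orb Λ) (Orb Λ × Orb Λ) ℂ} (h : IsDQGFeasibleSector a b γ Γ) (hab : a + b ≠ 0)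
    {w : Fin 2 → ℂ} (hw : w 0 * (a : ℂ) + w 1 * (b : ℂ) = 0) (Q k : Orb Λ) :
    ∑ Y : Orb Λ, w (ofLex Y).2 * Γ (Q, Y) (k, Y) = -(w (ofLex k).2 * γ Q k) := by
  rw [sum_orb_eq (fun Y : Orb Λ => w (ofLex Y).2 * Γ (Q, Y) (k, Y))]
  simp only [ofLex_toLex]
  rw [Finset.sum_add_distrib, ← Finset.mul_sum, ← Finset.mul_sum]
  rcases orb_cases k with hk | hk
  · rw [hk]
    simp only [ofLex_toLex]
    rw [sum_two_upUp_of_isDQGFeasibleSector h hab Q (ofLex k).1,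
      sum_two_upDown_of_isDQGFeasibleSector h hab Q (ofLex k).1]
    linear_combination γ Q (orb (ofLex k).1 0) * hw
  · rw [hk]
    simp only [ofLex_toLex]
    rw [sum_two_downUp_of_isDQGFeasibleSector h hab Q (ofLex k).1,
      sum_two_downDown_of_isDQGFeasibleSector h hab Q (ofLex k).1]
    linear_combination γ Q (orb (ofLex k).1 1) * hw

/-- **A row of the printed `T2` formula against the cubic part of the border vector** (pure algebra on
`t2Map_apply`, Nakata et al. (2008) §II.A): the seven terms of `Σ_Y w_{s(Y)} T2^{(i,j,k)}_{(P,Y,Y)}`,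
the Kronecker deltas in `Y` summed out. -/
private theorem sum_weight_mul_t2Map (γ : Matrix (Orb Λ) (Orb Λ) ℂ)
    (Γ : Matrix (Orb Λ × Orb Λ) (Orb Λ × Orb Λ) ℂ) (w : Fin 2 → ℂ) (P i j k : Orb Λ) :
    ∑ Y : Orb Λ, w (ofLex Y).2 * t2Map γ Γ (i, j, k) (P, Y, Y) =
      w (ofLex k).2 * Γ (i, j) (P, k) + w (ofLex i).2 * Γ (i, j) (k, P)
        - w (ofLex j).2 * Γ (j, i) (k, P)
        + (if P = i then (1 : ℂ) else 0) *
            (w (ofLex j).2 * γ j k - ∑ Y : Orb Λ, w (ofLex Y).2 * Γ (Y, j) (k, Y))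
        - (if P = j then (1 : ℂ) else 0) *
            (w (ofLex i).2 * γ i k - ∑ Y : Orb Λ, w (ofLex Y).2 * Γ (Y, i) (k, Y)) := by
  have hpt : ∀ Y : Orb Λ, w (ofLex Y).2 * t2Map γ Γ (i, j, k) (P, Y, Y) =
      (if k = Y then w (ofLex Y).2 * Γ (i, j) (P, Y) else 0)
      + (if Y = i then w (ofLex Y).2 * Γ (Y, j) (k, P) else 0)
      - (if Y = j then w (ofLex Y).2 * Γ (Y, i) (k, P) else 0)
      + (if P = i then (1 : ℂ) else 0) *
          ((if Y = j then w (ofLex Y).2 * γ Y k else 0) - w (ofLex Y).2 * Γ (Y, j) (k, Y))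
      - (if P = j then (1 : ℂ) else 0) *
          ((if Y = i then w (ofLex Y).2 * γ Y k else 0) - w (ofLex Y).2 * Γ (Y, i) (k, Y)) := by
    intro Y
    rw [t2Map_apply]
    split_ifs <;> ring
  rw [Finset.sum_congr rfl fun Y _ => hpt Y]
  simp only [Finset.sum_add_distrib, Finset.sum_sub_distrib, ← Finset.mul_sum, Finset.sum_ite_eq,
    Finset.sum_ite_eq', Finset.mem_univ, if_true]

/-! ### F2, closed form: `T2′ u` at every feasible point of the printed `S_z`-sector DQG programme -/

/-- **Closed form, cubic rows.** At every feasible point of the printed `S_z`-sector DQG programme with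
`a + b ≠ 0`, for spin weights `w_α a + w_β b = 0` and every row label `P`, the border vector
`u = Σ_Y w_{s(Y)} e_{(P,Y,Y)} + w_{s(P)} e_P` satisfies
`(T2′(γ, Γ) u)_{(i,j,k)} = (w_{s(k)} + w_{s(P)} − w_{s(i)} − w_{s(j)}) · Γ_{(i,j),(P,k)}`
(printed `T2` row + border column `X_{(ijk),P} = Γ_{(i,j),(P,k)}`; antisymmetry, the weighted E2
contraction and the selection rule of `γ` cancel everything else). -/
theorem t2PrimeMap_mulVec_borderVec_inl {a b : ℕ} {γ : Matrix (Orb Λ) (Orb Λ) ℂ}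
    {Γ : Matrix (Orb Λ × Orb Λ) (Orb Λ × Orb Λ) ℂ} (h : IsDQGFeasibleSector a b γ Γ) (hab : a + b ≠ 0)
    {w : Fin 2 → ℂ} (hw : w 0 * (a : ℂ) + w 1 * (b : ℂ) = 0) (P i j k : Orb Λ) :
    (t2PrimeMap γ Γ *ᵥ Sum.elim
        (fun t : Orb Λ × Orb Λ × Orb Λ => ∑ Y : Orb Λ, if t = (P, Y, Y) then w (ofLex Y).2 else 0)
        (fun l : Orb Λ => if l = P then w (ofLex P).2 else 0)) (Sum.inl (i, j, k)) =
      (w (ofLex k).2 + w (ofLex P).2 - w (ofLex i).2 - w (ofLex j).2) * Γ (i, j) (P, k) := by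
  rw [t2PrimeMap, Matrix.fromBlocks_mulVec]
  simp only [Sum.elim_inl, Sum.elim_comp_inl, Sum.elim_comp_inr, Pi.add_apply,
    mulVec_cubicVec_apply, mulVec_borderVec_apply, Matrix.of_apply]
  rw [sum_weight_mul_t2Map]
  have e2 : ∀ x : Orb Λ, ∑ Y : Orb Λ, w (ofLex Y).2 * Γ (Y, x) (k, Y) = w (ofLex k).2 * γ x k := by
    intro x
    have hs : ∀ Y : Orb Λ, w (ofLex Y).2 * Γ (Y, x) (k, Y) = -(w (ofLex Y).2 * Γ (x, Y) (k, Y)) := by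
      intro Y
      rw [h.dqg.swap_fst x Y (k, Y)]
      ring
    rw [Finset.sum_congr rfl fun Y _ => hs Y, Finset.sum_neg_distrib, sum_weight_mul_two h hab hw x k,
      neg_neg]
  have a2 : Γ (j, i) (k, P) = Γ (i, j) (P, k) := by
    rw [h.dqg.swap_fst i j (k, P), h.dqg.swap_snd (i, j) P k, neg_neg]
  rw [e2 j, e2 i, h.dqg.swap_snd (i, j) P k, a2]
  linear_combination (if P = i then (1 : ℂ) else 0) * weight_sub_mul_one h w j k
    - (if P = j then (1 : ℂ) else 0) * weight_sub_mul_one h w i k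

/-- **Closed form, border rows.** Under the same hypotheses `(T2′(γ, Γ) u)_l = 0` for every orbital `l`:
the row is `Σ_Y w_{s(Y)} Γ_{(l,Y),(P,Y)} + w_{s(P)} γ_{lP} = (w_α N_α + w_β N_β − w_{s(P)} + w_{s(P)}) γ_{lP}`
by E2 (addendum 17 §F.3, "border members … = 0 by E2 directly"). -/
theorem t2PrimeMap_mulVec_borderVec_inr {a b : ℕ} {γ : Matrix (Orb Λ) (Orb Λ) ℂ}
    {Γ : Matrix (Orb Λ × Orb Λ) (Orb Λ × Orb Λ) ℂ} (h : IsDQGFeasibleSector a b γ Γ) (hab : a + b ≠ 0)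
    {w : Fin 2 → ℂ} (hw : w 0 * (a : ℂ) + w 1 * (b : ℂ) = 0) (P l : Orb Λ) :
    (t2PrimeMap γ Γ *ᵥ Sum.elim
        (fun t : Orb Λ × Orb Λ × Orb Λ => ∑ Y : Orb Λ, if t = (P, Y, Y) then w (ofLex Y).2 else 0)
        (fun l : Orb Λ => if l = P then w (ofLex P).2 else 0)) (Sum.inr l) = 0 := by
  rw [t2PrimeMap, Matrix.fromBlocks_mulVec]
  simp only [Sum.elim_inr, Sum.elim_comp_inl, Sum.elim_comp_inr, Pi.add_apply,
    mulVec_cubicVec_apply, mulVec_borderVec_apply, Matrix.of_apply]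
  rw [sum_weight_mul_two h hab hw l P]
  ring

/-- **`u† T2′(γ, Γ) u = 0` at every DQG-sector-feasible pair** (`a + b ≠ 0`): on the support of `u`
the closed form has coefficient `w_{s(Y)} + w_{s(P)} − w_{s(P)} − w_{s(Y)} = 0`, and the border rows
vanish. No semidefiniteness is used. -/
theorem star_borderVec_dotProduct_t2PrimeMap_mulVec_borderVec {a b : ℕ}
    {γ : Matrix (Orb Λ) (Orb Λ) ℂ} {Γ : Matrix (Orb Λ × Orb Λ) (Orb Λ × Orb Λ) ℂ}
    (h : IsDQGFeasibleSector a b γ Γ) (hab : a + b ≠ 0) {w : Fin 2 → ℂ}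
    (hw : w 0 * (a : ℂ) + w 1 * (b : ℂ) = 0) (P : Orb Λ) :
    star (Sum.elim
        (fun t : Orb Λ × Orb Λ × Orb Λ => ∑ Y : Orb Λ, if t = (P, Y, Y) then w (ofLex Y).2 else 0)
        (fun l : Orb Λ => if l = P then w (ofLex P).2 else 0)) ⬝ᵥ
      (t2PrimeMap γ Γ *ᵥ Sum.elim
        (fun t : Orb Λ × Orb Λ × Orb Λ => ∑ Y : Orb Λ, if t = (P, Y, Y) then w (ofLex Y).2 else 0)
        (fun l : Orb Λ => if l = P then w (ofLex P).2 else 0)) = 0 := by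
  rw [dotProduct]
  refine Finset.sum_eq_zero fun I _ => ?_
  rcases I with ⟨i, j, k⟩ | l
  · by_cases ht : i = P ∧ j = k
    · obtain ⟨hi, hj⟩ := ht
      rw [hi, hj, t2PrimeMap_mulVec_borderVec_inl h hab hw P P k k]
      ring
    · have hu : (∑ Y : Orb Λ, if (i, j, k) = (P, Y, Y) then w (ofLex Y).2 else (0 : ℂ)) = 0 :=
        Finset.sum_eq_zero fun Y _ => if_neg fun hY => ht (by
          simp only [Prod.mk.injEq] at hY
          exact ⟨hY.1, hY.2.1.trans hY.2.2.symm⟩)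
      simp only [Pi.star_apply, Sum.elim_inl, hu, star_zero, zero_mul]
  · rw [t2PrimeMap_mulVec_borderVec_inr h hab hw P l, mul_zero]

/-! ### F2 at relaxation level, and the two-body selection rule -/

/-- **Theorem F2 at RELAXATION level (rdm-A, addendum 17 §F.3).** At every feasible point of the
printed `S_z`-sector `DQGT1T2′` programme (`IsDQGT1T2PrimeFeasibleSector`, Nakata et al. 2008 §II.A–C
with sector rows; `a + b ≠ 0`) — not only at the reduced density matrices of a sector state — the
border vector `u = Σ_Y w_{s(Y)} e_{(P,Y,Y)} + w_{s(P)} e_P` (`w_α a + w_β b = 0`; for `P = pα`,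
`w = (b, −a)` rdm-B's `u_p` of `T2PrimeSectorKernel.lean`) is a kernel vector of `T2′(γ, Γ)`:
`T2′ ⪰ 0` turns `u† T2′ u = 0` into `T2′ u = 0`. [cite: NakataEtAl2008, §II.B] -/
theorem t2PrimeMap_mulVec_borderVec_eq_zero {a b : ℕ} {γ : Matrix (Orb Λ) (Orb Λ) ℂ}
    {Γ : Matrix (Orb Λ × Orb Λ) (Orb Λ × Orb Λ) ℂ} (h : IsDQGT1T2PrimeFeasibleSector a b γ Γ)
    (hab : a + b ≠ 0) {w : Fin 2 → ℂ} (hw : w 0 * (a : ℂ) + w 1 * (b : ℂ) = 0) (P : Orb Λ) :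
    (t2PrimeMap γ Γ *ᵥ Sum.elim
        (fun t : Orb Λ × Orb Λ × Orb Λ => ∑ Y : Orb Λ, if t = (P, Y, Y) then w (ofLex Y).2 else 0)
        (fun l : Orb Λ => if l = P then w (ofLex P).2 else 0)) = 0 :=
  (h.t2Prime_psd.dotProduct_mulVec_zero_iff _).mp
    (star_borderVec_dotProduct_t2PrimeMap_mulVec_borderVec h.toIsDQGFeasibleSector hab hw P)

/-- **The printed sector `DQGT1T2′` programme forces the two-body `S_z` selection rule.** At every
feasible point with `a + b ≠ 0`, `Γ_{(i,j),(P,k)} = 0` whenever the spin charges of the two index pairs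
differ, `s(i) + s(j) ≠ s(P) + s(k)` (spins as `0 = α`, `1 = β`): the kernel row `(i,j,k)` of the
border vector at `P` with `w = (b, −a)` reads `∓(a + b) Γ_{(i,j),(P,k)} = 0`. (In the abstract
programme only `γ` carries a selection-rule row; for `Γ` it is a CONSEQUENCE of `T2′ ⪰ 0`.) -/
theorem two_spin_sel_of_isDQGT1T2PrimeFeasibleSector {a b : ℕ} {γ : Matrix (Orb Λ) (Orb Λ) ℂ}
    {Γ : Matrix (Orb Λ × Orb Λ) (Orb Λ × Orb Λ) ℂ} (h : IsDQGT1T2PrimeFeasibleSector a b γ Γ)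
    (hab : a + b ≠ 0) (i j P k : Orb Λ)
    (hs : (ofLex i).2.val + (ofLex j).2.val ≠ (ofLex P).2.val + (ofLex k).2.val) :
    Γ (i, j) (P, k) = 0 := by
  have hw : (![(b : ℂ), -(a : ℂ)] : Fin 2 → ℂ) 0 * (a : ℂ) +
      (![(b : ℂ), -(a : ℂ)] : Fin 2 → ℂ) 1 * (b : ℂ) = 0 := by
    rw [Matrix.cons_val_zero, Matrix.cons_val_one, Matrix.cons_val_zero]
    ring
  have hz := congr_fun (t2PrimeMap_mulVec_borderVec_eq_zero h hab hw P) (Sum.inl (i, j, k))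
  rw [t2PrimeMap_mulVec_borderVec_inl h.toIsDQGFeasibleSector hab hw, Pi.zero_apply] at hz
  refine (mul_eq_zero.mp hz).resolve_left ?_
  have key : ∀ τ : Fin 2, (![(b : ℂ), -(a : ℂ)] : Fin 2 → ℂ) τ = (b : ℂ) - ((a : ℂ) + b) * (τ.val : ℂ) :=
    Fin.forall_fin_two.mpr
      ⟨by rw [Matrix.cons_val_zero, Fin.val_zero, Nat.cast_zero]; ring,
        by rw [Matrix.cons_val_one, Matrix.cons_val_zero, Fin.val_one, Nat.cast_one]; ring⟩
  simp only [key]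
  have hab' : ((a : ℂ) + b) ≠ 0 := by exact_mod_cast hab
  have hne : (((ofLex i).2.val : ℂ) + (ofLex j).2.val) - ((ofLex P).2.val + (ofLex k).2.val) ≠ 0 := by
    rw [sub_ne_zero]
    exact_mod_cast hs
  intro hc
  exact mul_ne_zero hab' hne (by linear_combination hc)

/-- **Theorem F2, LINEAR (row-implied) version.** If `Γ` obeys the two-body `S_z` selection rule — as
every spin-blocked `qcl1` instance does structurally — then at every feasible point of the printed
`S_z`-sector DQG programme (`a + b ≠ 0`; NO `T1`/`T2′` semidefiniteness used) the border vector is a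
kernel vector of `T2′(γ, Γ)`: the closed-form coefficient `w_{s(k)} + w_{s(P)} − w_{s(i)} − w_{s(j)}`
vanishes on the charge-conserving entries and `Γ` vanishes on the others (addendum 17 §F.3,
"row-implied (LINEAR) version, member by member … modulo E1+E2"). -/
theorem t2PrimeMap_mulVec_borderVec_eq_zero_of_two_spin_sel {a b : ℕ} {γ : Matrix (Orb Λ) (Orb Λ) ℂ}
    {Γ : Matrix (Orb Λ × Orb Λ) (Orb Λ × Orb Λ) ℂ} (h : IsDQGFeasibleSector a b γ Γ) (hab : a + b ≠ 0)
    {w : Fin 2 → ℂ} (hw : w 0 * (a : ℂ) + w 1 * (b : ℂ) = 0)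
    (hΓ : ∀ i j P k : Orb Λ,
      (ofLex i).2.val + (ofLex j).2.val ≠ (ofLex P).2.val + (ofLex k).2.val → Γ (i, j) (P, k) = 0)
    (P : Orb Λ) :
    (t2PrimeMap γ Γ *ᵥ Sum.elim
        (fun t : Orb Λ × Orb Λ × Orb Λ => ∑ Y : Orb Λ, if t = (P, Y, Y) then w (ofLex Y).2 else 0)
        (fun l : Orb Λ => if l = P then w (ofLex P).2 else 0)) = 0 := by
  funext I
  rw [Pi.zero_apply]
  rcases I with ⟨i, j, k⟩ | l
  · rw [t2PrimeMap_mulVec_borderVec_inl h hab hw]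
    by_cases hs : (ofLex i).2.val + (ofLex j).2.val = (ofLex P).2.val + (ofLex k).2.val
    · have key : ∀ τ : Fin 2, w τ = w 0 + (w 1 - w 0) * (τ.val : ℂ) :=
        Fin.forall_fin_two.mpr
          ⟨by rw [Fin.val_zero, Nat.cast_zero]; ring, by rw [Fin.val_one, Nat.cast_one]; ring⟩
      have hc : w (ofLex k).2 + w (ofLex P).2 - w (ofLex i).2 - w (ofLex j).2 =
          (w 1 - w 0) * ((((ofLex P).2.val + (ofLex k).2.val : ℕ) : ℂ) -
            (((ofLex i).2.val + (ofLex j).2.val : ℕ) : ℂ)) := by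
        rw [key (ofLex k).2, key (ofLex P).2, key (ofLex i).2, key (ofLex j).2]
        push_cast
        ring
      rw [hc, hs, sub_self, mul_zero, zero_mul]
    · rw [hΓ i j P k hs, mul_zero]
  · exact t2PrimeMap_mulVec_borderVec_inr h hab hw P l

end Summit.Ventures.CertifiedQuantumChemistry

end
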